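import Mathlib

/-!
# EriceRemainderEnclosureHistoryAutonomyComparisonAgeCompositionMonoYoungest — (E80g) A FIRST BITE AT THE REMAINING MONOTONICITIES: MONO″ for a ONE-AGE
# profile with a one-lag kernel holds as soon as THE RECIPROCAL YOUNG KERNEL GROWS BY AT LEAST ONE PER PIN — the mechanism «the load forces its own decay»
# that the toy numerics of README g71∕e80 §4 (2) isolate (constant kernels oscillate and violate MONO″; self-consistent lone-age flows never do)

Cell `pub-balaban`, β-function sub-cell, BINDER row D4 «RemainderConst leaves for Bałaban's split» (`HOME/BINDER-OWNERS.md`; owner lineage `b2b-balaban-beta-an4`;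
this file by co-owner #2 lineage `b2b-balaban-beta-d4-p2`, generation 71), β-FLOW TEAM duty (1), FREEZE (0) honoured (def-free, Mathlib only; nothing restated).

HONEST FRAMING (page 1, verbatim and binding).  *"Discharging BetaPertH makes Bałaban's UV stability UNCONDITIONAL — a real constructive-QFT result; it is
NOT the continuum limit and NOT the Clay problem."*  THIS FILE DISCHARGES NOTHING OF THE KIND.  Elementary real algebra about ABSTRACT sequences — hypotheses of a
census, not facts; the age profile of Bałaban's (1.22) limit functional is NOT PRINTED ([I] p. 298; GAPS G-t4-U2-1∕-2) and NOT asserted.  Row D4 class UNCHANGED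
(critical-path width 0; instance 0∕1; D4 DISCHARGE NO DATE).  HONEST DEPENDENCY: continuum YM on T⁴ ⇐ BetaPertH ∧ nine spine estimates (0/9 proved); BetaPertH ⇐
(D1) ∧ (D4) ∧ CAP+tail; G-an2-4 gates asym, D1 and NE2/3/4.

THE POINT (census sense (α); route (N); this station `HOME/b2b-balaban-beta-d4-p2/g71/e80/README.md` §4 (2)).  After (E80f) `flow_nonneg_of_mono2` the first-order
remainder of route (N) is two monotonicities of the young solution `t` of the old surplus: MONO″ (`m ↦ RL i t m` non-increasing) and MONOa (its old reads
non-increasing).  THIS FILE is the SIMPLEST INSTANCE of MONO″, isolated as a template: ONE age with a ONE-LAG kernel `Kk m` (the youngest age `y = 1` ALONE —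
input `w` non-increasing; in a profile the youngest age sees the old surplus instead, which is only Harnack-bounded, so this is the one-age profile, NOT the
general level-1 statement).  **`one_lag_young_drops_antitone`**: if `0 ≤ Kk ≤ 1` and **`Kk (m+1)·(1 + Kk m) ≤ Kk m`** (⟺ `1∕Kk (m+1) − 1∕Kk m ≥ 1`,
`decay_of_inv_step`), then for every non-negative non-increasing zero-tailed `w` the young drops `d m = Kk m·t (m+1)` of the zero-tailed solution of `t m = w m −
Kk m·t (m+1)` are non-increasing — two lines once `0 ≤ t ≤ w` (`one_lag_sol_mem`): `d m − d (m+1) = Kk m·w(m+1) − (1+Kk m)·d(m+1)` and `d (m+1) ≤ Kk (m+1)·w (m+1)`.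
WHY THIS IS THE MECHANISM (toy numerics `g71/numerics/mono2_toy.py`, `mono2_toy2.py`): with CONSTANT `Kk = c` the recursion oscillates and `d_{N−2} = c(1−c) < c =
d_{N−1}` — MONO″ is false for arbitrary kernels; along the self-consistent lone-age flow (`Kk m = L h_{m+1}³∕2`, `a_{m+1} = a_m + b + L h_{m+1}`) the reciprocal
kernel grows by `≈ (3∕L)·a^{1∕2}·inc ≳ 3` per pin and the toy finds 0 violations for every truncation depth.  FOR THE SUCCESSOR: (i) the flow-side inequality
`2∕(L_1h_{m+2}³g_{m+2}) − 2∕(L_1h_{m+1}³g_{m+1}) ≥ 1` along box solutions (level increment ≥ the age's own read; dampings); (ii) windows `y > 1` (a `y`-lag version: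
the only negative term is the lag entering the window, README §4 (2)); (iii) the old surplus as input (Harnack-bounded, (E80d)); (iv) MONOa.  NOT CLAIMED: MONO″ or
MONOa for the flow; anything printed.

WHAT IS PROVED ([folklore]; 0 `def`, 0 sorry).  `one_lag_sol_mem`, **`one_lag_young_drops_antitone`**, `decay_of_inv_step`.
-/
noncomputable section
open Finset

namespace Summit.QuantumFields.BalabanUV.Beta.EriceRemainderEnclosureHistoryAutonomyComparisonAgeCompositionMonoYoungest

variable {N : ℕ} {Kk w t : ℕ → ℝ}

/-- **THE ONE-LAG SOLUTION LIES IN `[0, w]`.**  Kernel `0 ≤ Kk m ≤ 1`, input `w ≥ 0` non-increasing and zero beyond `N`, `t` zero beyond `N` with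
`t m = w m − Kk m·t (m+1)`: then `0 ≤ t m ≤ w m` at every depth (downward from the horizon). [folklore] -/
theorem one_lag_sol_mem (hK0 : ∀ m, 0 ≤ Kk m) (hK1 : ∀ m, Kk m ≤ 1)
    (hw0 : ∀ m, 0 ≤ w m) (hwa : ∀ m, w (m + 1) ≤ w m) (hwt : ∀ m, N < m → w m = 0)
    (htt : ∀ m, N < m → t m = 0) (hrec : ∀ m, t m = w m - Kk m * t (m + 1)) : ∀ m, 0 ≤ t m ∧ t m ≤ w m := by
  -- downward induction: the claim at all depths `≥ N + 1 − d`
  have key : ∀ d m, N + 1 - d ≤ m → 0 ≤ t m ∧ t m ≤ w m := by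
    intro d
    induction d with
    | zero => intro m hm; rw [htt m (by omega), hwt m (by omega)]; exact ⟨le_rfl, le_rfl⟩
    | succ d ih =>
      intro m hm
      rcases Nat.lt_or_ge N m with hlt | hge
      · rw [htt m hlt, hwt m hlt]; exact ⟨le_rfl, le_rfl⟩
      · have h1 := ih (m + 1) (by omega)
        rw [hrec m]
        constructor
        · have : Kk m * t (m + 1) ≤ 1 * w m := by
            calc Kk m * t (m + 1) ≤ Kk m * w (m + 1) := mul_le_mul_of_nonneg_left h1.2 (hK0 m)
              _ ≤ 1 * w m := mul_le_mul (hK1 m) (hwa m) (hw0 _) zero_le_one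
          linarith
        · nlinarith [hK0 m, h1.1]
  intro m
  exact key (N + 1) m (by omega)

/-- **MONO″ FOR A LONE YOUNGEST AGE (one lag), from ONE inequality on the kernel: the reciprocal young kernel grows by at least one per pin.**  Same setting;
if moreover `Kk (m+1)·(1 + Kk m) ≤ Kk m` for every `m` (equivalently `1∕Kk (m+1) ≥ 1∕Kk m + 1` where positive), then the young drops
`d m = Kk m·t (m+1)` are NON-INCREASING in the pin: `d (m+1) ≤ d m`.  Proof: `d m − d (m+1) = Kk m·w (m+1) − (1 + Kk m)·d (m+1)` and
`d (m+1) ≤ Kk (m+1)·w (m+2) ≤ Kk (m+1)·w (m+1)`.  For the flow's youngest age (`y = 1`, `Kk m = (L_1h_{m+1}³∕2)·g_{m+1}`) the hypothesis reads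
`2∕(L_1h_{m+2}³g_{m+2}) − 2∕(L_1h_{m+1}³g_{m+1}) ≥ 1`: «THE LOAD FORCES ITS OWN DECAY» — with CONSTANT kernels the one-lag recursion oscillates and MONO″
fails at every other pin (README g71∕e80 §4 (2), `g71/numerics/mono2_toy*.py`: 0 violations along self-consistent lone-age flows). [folklore] -/
theorem one_lag_young_drops_antitone (hK0 : ∀ m, 0 ≤ Kk m) (hK1 : ∀ m, Kk m ≤ 1)
    (hdec : ∀ m, Kk (m + 1) * (1 + Kk m) ≤ Kk m)
    (hw0 : ∀ m, 0 ≤ w m) (hwa : ∀ m, w (m + 1) ≤ w m) (hwt : ∀ m, N < m → w m = 0)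
    (htt : ∀ m, N < m → t m = 0) (hrec : ∀ m, t m = w m - Kk m * t (m + 1)) :
    ∀ m, Kk (m + 1) * t (m + 2) ≤ Kk m * t (m + 1) := by
  have ht := one_lag_sol_mem hK0 hK1 hw0 hwa hwt htt hrec
  intro m
  -- d (m+1) ≤ Kk (m+1) · w (m+1)
  have hd1 : Kk (m + 1) * t (m + 2) ≤ Kk (m + 1) * w (m + 1) :=
    (mul_le_mul_of_nonneg_left (ht (m + 2)).2 (hK0 _)).trans (mul_le_mul_of_nonneg_left (hwa (m + 1)) (hK0 _))
  -- d m = Kk m · (w (m+1) − d (m+1))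
  have hdm : Kk m * t (m + 1) = Kk m * w (m + 1) - Kk m * (Kk (m + 1) * t (m + 2)) := by rw [hrec (m + 1)]; ring
  rw [hdm]
  have hd0 : 0 ≤ Kk (m + 1) * t (m + 2) := mul_nonneg (hK0 _) (ht _).1
  nlinarith [hdec m, hw0 (m + 1), mul_le_mul_of_nonneg_left hd1 (by linarith [hK0 m] : (0:ℝ) ≤ 1 + Kk m)]

/-- **THE RECIPROCAL FORM OF THE DECAY HYPOTHESIS.**  For a positive kernel, `1∕Kk (m+1) − 1∕Kk m ≥ 1` implies `Kk (m+1)·(1 + Kk m) ≤ Kk m`. [folklore] -/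
theorem decay_of_inv_step (hKpos : ∀ m, 0 < Kk m) (hinv : ∀ m, 1 ≤ 1 / Kk (m + 1) - 1 / Kk m) :
    ∀ m, Kk (m + 1) * (1 + Kk m) ≤ Kk m := by
  intro m
  have h1 := hinv m
  have ha := hKpos m
  have hb := hKpos (m + 1)
  rw [div_sub_div _ _ hb.ne' ha.ne', le_div_iff₀ (mul_pos hb ha)] at h1
  nlinarith

end Summit.QuantumFields.BalabanUV.Beta.EriceRemainderEnclosureHistoryAutonomyComparisonAgeCompositionMonoYoungest

end
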